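import Summits.KontsevichZagierPeriods.Zeta5Search.TwoTaleOmega.FormalBarnesPoly

/-!
# Formal Barnes functionals II — partial-fraction data, the functional, shift and crossing laws
(cell `pub-zeta5`, fam-tele gen 4)

HONEST FRAMING: systematic search; no irrationality claim unless certified.

OUR infrastructure (Summit side; no named facts, no analysis), continuing `FormalBarnesPoly`: the kernel blueprint
`families/tele/RECURRENCE.md §13`.  Partial-fraction DATA `v : PF` = (polynomial part, simple parts `α_k/(t+k)`,
double parts `β_k/(t+k)²`, `k ∈ ℤ`, finitely supported); the FORMAL value of `(1/2πi)∫_{Re t = s−1/2} (π/sin πt)² v(t) dt`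
is the triple `(lam0 d s v, lam1 s v, lam2 v)` read as `e₀`-, `ζ(2)`- and `ζ(3)`-coordinates, DEFINED by the weights
`phi0/phi1/psi0`; the formal residue at the integer `s` is `(rho0 s v, rho1 s v, 0)`.  Theorems (finite algebra only):
SHIFT law `lam•_shift` (`Λ_s[v(·+1)] = Λ_{s+1}[v]`), CROSSING law `lam•_crossing` (`Λ_{s+1}[v] − Λ_s[v] = ρ_s(v)`),
linearity, contour moves `lam•_move(_eq)` and the formal TELESCOPING step `lam•_telescope`
(`u = S w − w ⇒ Λ_s[u] − Λ_s[w]`-form: `Λ_s[S w] − Λ_s[w] = ρ_s(w)`), which is the analytic heart of Zudilin's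
two-tale argument with the contour removed.  The `ζ(3)`-coordinate `lam2` is shift-invariant, so it never enters.
-/

noncomputable section

open Polynomial Finset fwdDiff

namespace Summit.KontsevichZagierPeriods.Zeta5Search.FormalBarnes

/-! ### Harmonic-type sums and the polar weights

`phi0/phi1` are the `e₀`/`e₁`-coordinates of the formal value `φ(m)` of the functional on `1/(t+k)` (`m = k+s−1` the
position of the pole relative to the contour), `psi0` the `e₀`-coordinate of its value `ψ(m)` on `1/(t+k)²` (the
`e₂`-coordinate of `ψ` is the constant `2` and is carried by `lam2`).  They are DEFINED so that the crossing law holds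
(`phi0_crossing`, `phi1_crossing`, `psi0_crossing`); analytically `φ(m) = ζ(2) − H₂(m)` (`m ≥ 0`), `−ζ(2) + H₂(−m−1)`
(`m < 0`), cf. `Denom/KernelPolarMoment.polarLine_half_eq` — never used here. -/

/-- `H₂(m) = Σ_{l=1}^{m} l⁻²` (definitionally `Zudilin2014.FirstTale.harmTwo`). -/
def H2 (m : ℕ) : ℚ := ∑ l ∈ range m, 1 / ((l + 1 : ℚ) ^ 2)

/-- `H₃(m) = Σ_{l=1}^{m} l⁻³`. -/
def H3 (m : ℕ) : ℚ := ∑ l ∈ range m, 1 / ((l + 1 : ℚ) ^ 3)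

/-- Recursion `H₂(n+1) = H₂(n) + 1/(n+1)²`. -/
theorem H2_succ (m : ℕ) : H2 (m + 1) = H2 m + 1 / ((m + 1 : ℚ) ^ 2) := by
  unfold H2; rw [sum_range_succ]

/-- Recursion `H₃(n+1) = H₃(n) + 1/(n+1)³`. -/
theorem H3_succ (m : ℕ) : H3 (m + 1) = H3 m + 1 / ((m + 1 : ℚ) ^ 3) := by
  unfold H3; rw [sum_range_succ]

/-- `e₀`-coordinate of `φ(m)`. -/
def phi0 : ℤ → ℚ
  | Int.ofNat n => -H2 n
  | Int.negSucc n => H2 n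

/-- `e₁`-coordinate of `φ(m)` (the side of the contour the pole lies on). -/
def phi1 : ℤ → ℚ
  | Int.ofNat _ => 1
  | Int.negSucc _ => -1

/-- `e₀`-coordinate of `ψ(m)`. -/
def psi0 : ℤ → ℚ
  | Int.ofNat n => -2 * H3 n
  | Int.negSucc n => -2 * H3 n

/-- Crossing law for `φ`, `e₀`-coordinate: `φ₀(m+1) − φ₀(m) = −1/(m+1)²` (at `m = −1` both sides are `0`, the
right one by `x/0 = 0`). -/
theorem phi0_crossing (m : ℤ) : phi0 (m + 1) - phi0 m = -1 / ((m : ℚ) + 1) ^ 2 := by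
  rcases m with n | n
  · show -H2 (n + 1) - (-H2 n) = -1 / (((Int.ofNat n : ℤ) : ℚ) + 1) ^ 2
    rw [Int.ofNat_eq_natCast, Int.cast_natCast, H2_succ]; ring
  · rcases n with _ | n
    · show -H2 0 - H2 0 = -1 / (((Int.negSucc 0 : ℤ) : ℚ) + 1) ^ 2
      simp [H2]
    · show H2 n - H2 (n + 1) = -1 / (((Int.negSucc (n + 1) : ℤ) : ℚ) + 1) ^ 2
      have e : (((Int.negSucc (n + 1) : ℤ) : ℚ) + 1) = -((n : ℚ) + 1) := by push_cast; ring
      have h : (-((n : ℚ) + 1)) ≠ 0 := neg_ne_zero.2 (by positivity)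
      rw [e, H2_succ]
      field_simp
      ring

/-- Crossing law for `φ`, `e₁`-coordinate: the pole is crossed exactly when `m = −1`. -/
theorem phi1_crossing (m : ℤ) : phi1 (m + 1) - phi1 m = if m = -1 then 2 else 0 := by
  rcases m with n | n
  · show phi1 (Int.ofNat (n + 1)) - phi1 (Int.ofNat n) = _
    have : (Int.ofNat n : ℤ) ≠ -1 := by simp
    simp [phi1]
  · rcases n with _ | n
    · show phi1 (Int.ofNat 0) - phi1 (Int.negSucc 0) = _
      simp [phi1]; norm_num
    · show phi1 (Int.negSucc n) - phi1 (Int.negSucc (n + 1)) = _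
      have : Int.negSucc (n + 1) ≠ -1 := by simp [Int.negSucc_eq]; omega
      simp [phi1, this]

/-- Crossing law for `ψ`, `e₀`-coordinate: `ψ₀(m+1) − ψ₀(m) = −2/(m+1)³`. -/
theorem psi0_crossing (m : ℤ) : psi0 (m + 1) - psi0 m = -2 / ((m : ℚ) + 1) ^ 3 := by
  rcases m with n | n
  · show -2 * H3 (n + 1) - (-2 * H3 n) = -2 / (((Int.ofNat n : ℤ) : ℚ) + 1) ^ 3
    rw [Int.ofNat_eq_natCast, Int.cast_natCast, H3_succ]; ring
  · rcases n with _ | n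
    · show -2 * H3 0 - (-2 * H3 0) = -2 / (((Int.negSucc 0 : ℤ) : ℚ) + 1) ^ 3
      simp [H3]
    · show -2 * H3 n - (-2 * H3 (n + 1)) = -2 / (((Int.negSucc (n + 1) : ℤ) : ℚ) + 1) ^ 3
      have e : (((Int.negSucc (n + 1) : ℤ) : ℚ) + 1) = -((n : ℚ) + 1) := by push_cast; ring
      have h : (-((n : ℚ) + 1)) ≠ 0 := neg_ne_zero.2 (by positivity)
      rw [e, H3_succ]
      field_simp
      ring

/-! ### Partial-fraction data and the functional, coordinatewise -/

/-- Partial-fraction DATA of a rational function with poles of order `≤ 2` at integers: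
`eval v t = poly(t) + Σ_k simple_k/(t+k) + Σ_k double_k/(t+k)²`. -/
structure PF where
  /-- polynomial part -/
  poly : ℚ[X]
  /-- coefficient of `1/(t+k)` -/
  simple : ℤ →₀ ℚ
  /-- coefficient of `1/(t+k)²` -/
  double : ℤ →₀ ℚ

namespace PF

/-- The rational function the data represent (junk at the poles). -/
def eval (v : PF) (t : ℚ) : ℚ :=
  v.poly.eval t + v.simple.sum (fun k a => a / (t + k)) + v.double.sum (fun k b => b / (t + k) ^ 2)

/-- The shift `(S v)(t) = v(t+1)`. -/
def shift (v : PF) : PF :=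
  ⟨v.poly.comp (X + 1), v.simple.mapDomain (· + 1), v.double.mapDomain (· + 1)⟩

/-- Sum of data. -/
def add (v w : PF) : PF := ⟨v.poly + w.poly, v.simple + w.simple, v.double + w.double⟩

/-- Scalar multiple of data. -/
def smul (c : ℚ) (v : PF) : PF := ⟨C c * v.poly, c • v.simple, c • v.double⟩

end PF

/-- `e₀`-coordinate of `Λ_s[v]` (node `s` = contour `Re t = s − 1/2`; truncation `d ≥ deg poly`). -/
def lam0 (d : ℕ) (s : ℤ) (v : PF) : ℚ :=
  lamPoly d s v.poly + v.simple.sum (fun k a => a * phi0 (k + s - 1)) + v.double.sum (fun k b => b * psi0 (k + s - 1))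

/-- `e₁`-coordinate ("coefficient of ζ(2)") of `Λ_s[v]`. -/
def lam1 (s : ℤ) (v : PF) : ℚ := v.simple.sum (fun k a => a * phi1 (k + s - 1))

/-- `e₂`-coordinate ("coefficient of ζ(3)") of `Λ_s[v]`: independent of `s`, so it never enters a crossing. -/
def lam2 (v : PF) : ℚ := v.double.sum (fun _ b => 2 * b)

/-- `e₀`-coordinate of the formal residue `ρ_s(v)` of `(π/sin πt)² v(t)` at the integer `s`:
the `(t−s)¹`-coefficient of `v` (terms with `k = −s` contribute `0` by `x/0 = 0`, as they should). -/
def rho0 (s : ℤ) (v : PF) : ℚ :=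
  (derivative v.poly).eval (s : ℚ) - v.simple.sum (fun k a => a / ((s : ℚ) + k) ^ 2)
    - v.double.sum (fun k b => 2 * b / ((s : ℚ) + k) ^ 3)

/-- `e₁`-coordinate of `ρ_s(v)`: `2 ×` the `(t−s)⁻¹`-coefficient (from `(π/sin πt)² = (t−s)⁻² + 2ζ(2) + …`). -/
def rho1 (s : ℤ) (v : PF) : ℚ := 2 * v.simple (-s)

/-! ### The SHIFT law (A) -/

/-- SHIFT law, `1`-coordinate: `Λ⁰_s[v(·+1)] = Λ⁰_{s+1}[v]`. -/
theorem lam0_shift (d : ℕ) (s : ℤ) (v : PF) : lam0 d s v.shift = lam0 d (s + 1) v := by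
  unfold lam0 PF.shift
  simp only
  rw [Finsupp.sum_mapDomain_index (fun _ => by simp) (fun _ _ _ => by ring),
    Finsupp.sum_mapDomain_index (fun _ => by simp) (fun _ _ _ => by ring),
    show ((s : ℤ) : ℚ) = (s : ℚ) from rfl, lamPoly_shift]
  push_cast
  congr 1
  · congr 1
    exact Finset.sum_congr rfl fun k _ => by ring_nf
  · exact Finset.sum_congr rfl fun k _ => by ring_nf

/-- SHIFT law, `ζ(2)`-coordinate: `Λ¹_s[v(·+1)] = Λ¹_{s+1}[v]`. -/
theorem lam1_shift (s : ℤ) (v : PF) : lam1 s v.shift = lam1 (s + 1) v := by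
  unfold lam1 PF.shift
  simp only
  rw [Finsupp.sum_mapDomain_index (fun _ => by simp) (fun _ _ _ => by ring)]
  exact Finset.sum_congr rfl fun k _ => by ring_nf

/-- SHIFT law, `ζ(3)`-coordinate (which does not depend on the node). -/
theorem lam2_shift (v : PF) : lam2 v.shift = lam2 v := by
  unfold lam2 PF.shift
  simp only
  rw [Finsupp.sum_mapDomain_index (fun _ => by simp) (fun _ _ _ => by ring)]

/-! ### The CROSSING law (B) -/

/-- CROSSING law, `1`-coordinate: `Λ⁰_{s+1}[v] − Λ⁰_s[v] = ρ⁰_s(v)` (truncation `d ≥ deg` of the polynomial part). -/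
theorem lam0_crossing (d : ℕ) (s : ℤ) (v : PF) (hd : v.poly.natDegree ≤ d) :
    lam0 d (s + 1) v - lam0 d s v = rho0 s v := by
  unfold lam0 rho0 Finsupp.sum
  have hP := lamPoly_crossing v.poly (s : ℚ) hd
  push_cast
  rw [show lamPoly d ((s : ℚ) + 1) v.poly = lamPoly d (s : ℚ) v.poly + (derivative v.poly).eval (s : ℚ) by
    rw [← hP]; ring]
  have h1 : ∀ k ∈ v.simple.support,
      v.simple k * phi0 (k + (s + 1) - 1) - v.simple k * phi0 (k + s - 1) = -(v.simple k / ((s : ℚ) + k) ^ 2) := by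
    intro k _
    rw [← mul_sub, show k + (s + 1) - 1 = (k + s - 1) + 1 by ring, phi0_crossing]
    push_cast
    rw [show ((k : ℚ) + s - 1 + 1) = (s : ℚ) + k by ring]
    ring
  have h2 : ∀ k ∈ v.double.support,
      v.double k * psi0 (k + (s + 1) - 1) - v.double k * psi0 (k + s - 1) = -(2 * v.double k / ((s : ℚ) + k) ^ 3) := by
    intro k _
    rw [← mul_sub, show k + (s + 1) - 1 = (k + s - 1) + 1 by ring, psi0_crossing]
    push_cast
    rw [show ((k : ℚ) + s - 1 + 1) = (s : ℚ) + k by ring]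
    ring
  have e1 := Finset.sum_congr rfl h1
  have e2 := Finset.sum_congr rfl h2
  rw [Finset.sum_sub_distrib] at e1 e2
  rw [Finset.sum_neg_distrib] at e1 e2
  linear_combination e1 + e2

/-- CROSSING law, `ζ(2)`-coordinate: `Λ¹_{s+1}[v] − Λ¹_s[v] = ρ¹_s(v) = 2α_{−s}`. -/
theorem lam1_crossing (s : ℤ) (v : PF) : lam1 (s + 1) v - lam1 s v = rho1 s v := by
  unfold lam1 rho1 Finsupp.sum
  rw [← Finset.sum_sub_distrib]
  have h : ∀ k ∈ v.simple.support,
      v.simple k * phi1 (k + (s + 1) - 1) - v.simple k * phi1 (k + s - 1) = if k = -s then 2 * v.simple k else 0 := by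
    intro k _
    rw [← mul_sub, show k + (s + 1) - 1 = (k + s - 1) + 1 by ring, phi1_crossing]
    by_cases hk : k = -s
    · subst hk; simp [mul_comm]
    · have : k + s - 1 ≠ -1 := fun h => hk (by linarith)
      simp [hk, this]
  rw [Finset.sum_congr rfl h, Finset.sum_ite_eq']
  by_cases hs : -s ∈ v.simple.support
  · rw [if_pos hs]
  · rw [if_neg hs, Finsupp.notMem_support_iff.1 hs, mul_zero]

/-! ### Linearity -/

/-- Additivity of `Λ⁰` in the data. -/
theorem lam0_add (d : ℕ) (s : ℤ) (v w : PF) : lam0 d s (v.add w) = lam0 d s v + lam0 d s w := by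
  unfold lam0 PF.add
  simp only
  rw [lamPoly_add, Finsupp.sum_add_index' (fun _ => by ring) (fun _ _ _ => by ring),
    Finsupp.sum_add_index' (fun _ => by ring) (fun _ _ _ => by ring)]
  ring

/-- Additivity of `Λ¹` in the data. -/
theorem lam1_add (s : ℤ) (v w : PF) : lam1 s (v.add w) = lam1 s v + lam1 s w := by
  unfold lam1 PF.add
  simp only
  rw [Finsupp.sum_add_index' (fun _ => by ring) (fun _ _ _ => by ring)]

/-- Additivity of `Λ²` in the data. -/
theorem lam2_add (v w : PF) : lam2 (v.add w) = lam2 v + lam2 w := by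
  unfold lam2 PF.add
  simp only
  rw [Finsupp.sum_add_index' (fun _ => by ring) (fun _ _ _ => by ring)]

/-- Homogeneity of `Λ⁰` in the data. -/
theorem lam0_smul (d : ℕ) (s : ℤ) (c : ℚ) (v : PF) : lam0 d s (v.smul c) = c * lam0 d s v := by
  unfold lam0 PF.smul
  simp only
  rw [lamPoly_smul, Finsupp.sum_smul_index' (fun _ => by ring), Finsupp.sum_smul_index' (fun _ => by ring)]
  simp only [smul_eq_mul]
  unfold Finsupp.sum
  rw [mul_add, mul_add, Finset.mul_sum, Finset.mul_sum]
  congr 1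
  · congr 1
    exact Finset.sum_congr rfl fun _ _ => by ring
  · exact Finset.sum_congr rfl fun _ _ => by ring

/-- Homogeneity of `Λ¹` in the data. -/
theorem lam1_smul (s : ℤ) (c : ℚ) (v : PF) : lam1 s (v.smul c) = c * lam1 s v := by
  unfold lam1 PF.smul
  simp only
  rw [Finsupp.sum_smul_index' (fun _ => by ring)]
  simp only [smul_eq_mul]
  unfold Finsupp.sum
  rw [Finset.mul_sum]
  exact Finset.sum_congr rfl fun _ _ => by ring

/-! ### Contour moves: iterating the crossing law -/

/-- Moving the contour `n` steps to the right: `Λ_{s+n} − Λ_s = Σ_{i<n} ρ_{s+i}` (`e₀`-coordinate). -/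
theorem lam0_move (d : ℕ) (s : ℤ) (v : PF) (hd : v.poly.natDegree ≤ d) (n : ℕ) :
    lam0 d (s + n) v - lam0 d s v = ∑ i ∈ range n, rho0 (s + i) v := by
  induction n with
  | zero => simp
  | succ n ih =>
    rw [sum_range_succ, ← ih, show s + ((n + 1 : ℕ) : ℤ) = (s + n) + 1 by push_cast; ring,
      ← lam0_crossing d (s + n) v hd]
    ring

/-- Same for the `e₁`-coordinate. -/
theorem lam1_move (s : ℤ) (v : PF) (n : ℕ) :
    lam1 (s + n) v - lam1 s v = ∑ i ∈ range n, rho1 (s + i) v := by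
  induction n with
  | zero => simp
  | succ n ih =>
    rw [sum_range_succ, ← ih, show s + ((n + 1 : ℕ) : ℤ) = (s + n) + 1 by push_cast; ring, ← lam1_crossing (s + n) v]
    ring

/-- **Contour equivalence** (C): if no residue lies between, the functional does not see the move. -/
theorem lam0_move_eq (d : ℕ) (s : ℤ) (v : PF) (hd : v.poly.natDegree ≤ d) (n : ℕ)
    (h : ∀ i, i < n → rho0 (s + i) v = 0) : lam0 d (s + n) v = lam0 d s v := by
  have := lam0_move d s v hd n
  rw [Finset.sum_eq_zero fun i hi => h i (mem_range.1 hi)] at this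
  linarith

/-- Moving the node, `ζ(2)`-coordinate, solved for `Λ¹_{s+n}`. -/
theorem lam1_move_eq (s : ℤ) (v : PF) (n : ℕ) (h : ∀ i, i < n → rho1 (s + i) v = 0) :
    lam1 (s + n) v = lam1 s v := by
  have := lam1_move s v n
  rw [Finset.sum_eq_zero fun i hi => h i (mem_range.1 hi)] at this
  linarith

/-! ### The telescoping step, formally

If the data `u` telescope — `u = S w − w` for some data `w` — then `Λ_s[u] = ρ_s(w)`: the whole "integral of a
telescoping sum = residues between the two contours" argument, with no contour. Combined with linearity this is the
STEP LEMMA of the blueprint: `Σ_k c_k Λ_s[data R_k] = ρ_s(w) = 0` under the legitimacy conditions. -/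

/-- **Telescoping step, `1`-coordinate**: for `u = w(·+1)`, `Λ⁰_s[u] − Λ⁰_s[w] = ρ⁰_s(w)`. -/
theorem lam0_telescope (d : ℕ) (s : ℤ) (u w : PF) (hu : u = w.shift) (hd : w.poly.natDegree ≤ d) :
    lam0 d s u - lam0 d s w = rho0 s w := by
  subst hu
  rw [lam0_shift, lam0_crossing d s w hd]

/-- **Telescoping step, `ζ(2)`-coordinate**: for `u = w(·+1)`, `Λ¹_s[u] − Λ¹_s[w] = ρ¹_s(w)`. -/
theorem lam1_telescope (s : ℤ) (u w : PF) (hu : u = w.shift) : lam1 s u - lam1 s w = rho1 s w := by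
  subst hu
  rw [lam1_shift, lam1_crossing]

/-- **Telescoping step, `ζ(3)`-coordinate**: for `u = w(·+1)` the `ζ(3)`-coordinate does not move. -/
theorem lam2_telescope (u w : PF) (hu : u = w.shift) : lam2 u - lam2 w = 0 := by
  subst hu
  rw [lam2_shift, sub_self]

end Summit.KontsevichZagierPeriods.Zeta5Search.FormalBarnes
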